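import Summits.QuantumFields.YangMills.Theorems.BalabanUVNodesN15BumpCover
import Summits.QuantumFields.YangMills.Theorems.BalabanUVNodesN15BumpTwoGridFit
import HarnessLib

/-!
# THE SMOOTH CUT-OFF WITH A PLATEAU, VI: THE BUMP AT THE COVER, TWO SPACINGS — the value fit `hfitχ`, the shifted value fits `hfit₁`∕`hfit₁b` and the difference-quotient fits
# `hfit₂`∕`hfit₂b` of `χ̃_k = bcube (2q) (coverXi M n w) R k` between the cover's two spacings `n = L^k` and `n′ = L^r·L^k` along King's pairing `kingPrV` (FILE III run on FILE 66
# `coverXi_shift` ×2 and FILE 67 `coverXi_offset`; constants `oχ = oχ₁ = π(d+1)∕(L^k w)`, `oχ₂ = w⁻¹(L^k w)⁻¹(32π⁴ + π²(d+1))`) (dag-n15-w4 g4, width seat on N15 = NE2)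

Cell `pub-ymgap`, seat `pub-ymgap-dag-n15-w4` (director №399 (3a) width; HUMAN RULING D-0062), generation 4.  `bears_on: R4∕N15 · K3⁸ SpineGivenEndpointR13SepCoPHV
(stmt-QuantumFields-27366)`.  Filed `--supports stmt-QuantumFields-27366 --as helper` — COUNT-NEUTRAL.  Theorems only (0 `def`, 0 `sorry`).  Imports BY NAME this seat's FILE V
`…N15BumpCover` (`two_mul_q_pos_of_cover`; through it FILE II and dag-n15-c FILES 66∕67∕72) and FILE III `…N15BumpTwoGridFit` (`abs_fgrad_bcube_two_grid_le`, `abs_bgrad_bcube_two_grid_le`,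
`abs_bcube_shift_sub_bcube_shift_le`, `abs_bcube_shift_symm_sub_bcube_shift_symm_le`).  Nothing in the tree is modified.

WHY.  Files 45∕48 (`hasMaj_idef_glueInv_smoothCutDressed(_localGauges)`) display the bump's two-grid fits `hfitχ ≤ oχ`, `hfit₁, hfit₁b ≤ oχ₁`, `hfit₂, hfit₂b ≤ oχ₂` between a fine and a
coarse member paired by `π`; at dag-n15-c's cover the pair is (`n′ = L^r·L^k`, `n = L^k`) along `kingPrV L k r M` (FILE 67 §3, FILE 74), the steps are `s′ = (L^r L^k w)⁻¹`, `s = (L^k w)⁻¹ =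
L^r s′`, the weights satisfy `n s = n′ s′ = w⁻¹`, and the coordinate offsets are `i_ν s′` with `i_ν ≤ L^r` (FILE 67 `coverXi_offset`).  FILE III's generic two-grid theorems then read:
* `coverBump_params` (the bookkeeping), ★★ `abs_bcube_cover_fine_sub_le` (`hfitχ ≤ π(d+1)∕(L^k w)`, FILE II `abs_bcube_sub_bcube_le` + FILE 67 `coverXi_fine_sub_eq`),
* ★★ `abs_bcube_cover_shift_fine_sub_le` (`hfit₁ ≤ π(d+1)∕(L^k w)`), ★★ `abs_bcube_cover_shift_symm_fine_sub_le` (`hfit₁b ≤ 2π(d+1)∕(L^k w)`), ★ `abs_bcube_cover_shift_fine_sub_le_two` (the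
  common letter `oχ₁ = 2π(d+1)∕(L^k w)`),
* ★★★ `abs_fgrad_bcube_cover_two_grid_le` ∕ `abs_bgrad_bcube_cover_two_grid_le` (`hfit₂∕hfit₂b ≤ w⁻¹(L^k w)⁻¹(32π⁴ + π²(d+1))`; side conditions `0 ≤ R`, `2R + 4 ≤ 2q`).

HONEST FRAMING ∕ LIMITS.  One-line instances of LANDED FILE III at dag-n15-c's cover data; no operator estimate; [B9] (3.62)–(3.65) pp.402–403 and Thm 3.14 pp.426–427 are SHAPES ∕
the difference template only — nothing of [B5]∕[B6]∕[B9] asserted.  `U ≡ 1` doubled-cube torus MODEL geometry of dag-n15-a∕dag-n15-c.  NE2⁺ NOT PRINTED, NOT proved; N15 NOT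
discharged; counts of record UNMOVED (typed 28∕28 · discharged 5∕27); one finite 𝕋⁴ at fixed ε — NOT infinite volume, NOT OS on ℝ⁴, NOT a mass gap, NOT Clay; R4 closes the
conditional finite-𝕋⁴ rung `BalabanLadder.UV` only.  Restate-immune (no Theses import).
-/

noncomputable section

namespace Summit.QuantumFields.YangMills.BalabanUVNodes.N15.Gluing

open Real
open Literature.MathematicalPhysics.QuantumFieldTheory.Balaban1983to89
open Literature.MathematicalPhysics.QuantumFieldTheory.Balaban1983to89.B5Prop11Plancherel (Tor fine)
open Summit.QuantumFields.YangMills.BalabanUVNodes.N15.BackgroundLayer (fgrad bgrad)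
open Summit.QuantumFields.YangMills.BalabanUVNodes.N15.VectorPiece (bshiftEquiv kingPrV)

variable {d : ℕ}

/-! ## §1 Two spacings `n = L^k`, `n′ = L^r·L^k` along King's pairing: the value fits and the difference-quotient fits -/

section TwoGrid

variable {M : Fin (d + 1) → ℕ} [∀ μ, NeZero (M μ)] {L kk r w q : ℕ} [NeZero L] (R : ℝ)

omit [∀ μ, NeZero (M μ)] in
/-- the two-grid parameters of the cover: `s = (L^k w)⁻¹ = L^r·s′`, `s′ = (L^r L^k w)⁻¹ ∈ [0, 1]`, `L^k·s = L^r L^k·s′ = w⁻¹`, `1 ≤ L^r`. [folklore] -/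
theorem coverBump_params (hw : 0 < w) :
    1 ≤ L ^ r ∧ (0 : ℝ) ≤ (((L ^ r * L ^ kk : ℕ) : ℝ) * w)⁻¹ ∧ (((L ^ r * L ^ kk : ℕ) : ℝ) * w)⁻¹ ≤ 1 ∧
      (((L ^ kk : ℕ) : ℝ) * w)⁻¹ = ((L ^ r : ℕ) : ℝ) * (((L ^ r * L ^ kk : ℕ) : ℝ) * w)⁻¹ ∧ ((L ^ kk : ℕ) : ℝ) * (((L ^ kk : ℕ) : ℝ) * w)⁻¹ = ((w : ℝ))⁻¹ ∧
      ((L ^ r * L ^ kk : ℕ) : ℝ) * (((L ^ r * L ^ kk : ℕ) : ℝ) * w)⁻¹ = ((w : ℝ))⁻¹ := by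
  have hL : 1 ≤ L := Nat.one_le_iff_ne_zero.mpr (NeZero.ne L)
  have hLr : 1 ≤ L ^ r := Nat.one_le_pow _ _ hL
  have hLk : 1 ≤ L ^ kk := Nat.one_le_pow _ _ hL
  have hw' : (0 : ℝ) < w := by exact_mod_cast hw
  have hLr' : (1 : ℝ) ≤ ((L ^ r : ℕ) : ℝ) := by exact_mod_cast hLr
  have hLk' : (1 : ℝ) ≤ ((L ^ kk : ℕ) : ℝ) := by exact_mod_cast hLk
  have hw1 : (1 : ℝ) ≤ w := by exact_mod_cast hw
  have hprod : ((L ^ r * L ^ kk : ℕ) : ℝ) = ((L ^ r : ℕ) : ℝ) * ((L ^ kk : ℕ) : ℝ) := by push_cast; ring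
  have hA : (1 : ℝ) ≤ ((L ^ r * L ^ kk : ℕ) : ℝ) * w := by rw [hprod]; nlinarith
  refine ⟨hLr, by positivity, inv_le_one_of_one_le₀ hA, ?_, ?_, ?_⟩
  · rw [hprod]; field_simp
  · field_simp
  · field_simp

/-- ★★ **THE VALUE FIT `hfitχ` AT THE COVER**: `|χ̃′_k(x′) − χ̃_k(πx′)| ≤ π(d+1)∕(L^k w)` (FILE II `abs_bcube_sub_bcube_le`, FILE 67 `coverXi_fine_sub_eq`: the fine and coarse
coordinates differ by `< (L^k w)⁻¹`). [cite: Balaban1985BackgroundPropagators, Thm 3.14 pp.426–427 (difference template: shape)] -/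
theorem abs_bcube_cover_fine_sub_le (hM : ∀ ν, M ν = 2 * q * w) (hw : 0 < w) (k : Fin (d + 1) → ZMod (2 * q)) (x' : Tor (fine (L ^ r * L ^ kk) M) × Fin (d + 1)) :
    |bcube (2 * q) (coverXi M (L ^ r * L ^ kk) w) R k x' - bcube (2 * q) (coverXi M (L ^ kk) w) R k (kingPrV L kk r M x')| ≤ π * (d + 1) / (((L ^ kk : ℕ) : ℝ) * w) := by
  have hL : 0 < L := Nat.pos_of_ne_zero (NeZero.ne L)
  have hw' : (0 : ℝ) < w := by exact_mod_cast hw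
  have hLk : (0 : ℝ) < ((L ^ kk : ℕ) : ℝ) := by positivity
  have hLr : (0 : ℝ) < ((L ^ r : ℕ) : ℝ) := by positivity
  have hq := two_mul_q_pos_of_cover hM
  refine (abs_bcube_sub_bcube_le (2 * q) (coverXi M (L ^ r * L ^ kk) w) R (coverXi M (L ^ kk) w) hq k x' (kingPrV L kk r M x')).trans ?_
  have hterm : ∀ ν, |cenRep (2 * q) (coverXi M (L ^ r * L ^ kk) w ν x' - coverXi M (L ^ kk) w ν (kingPrV L kk r M x'))| ≤ 1 / (((L ^ kk : ℕ) : ℝ) * w) := by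
    intro ν
    refine (abs_cenRep_le_abs_sub hq _ 0).trans ?_
    rw [Int.cast_zero, zero_mul, sub_zero, coverXi_fine_sub_eq, abs_of_nonneg (by positivity), div_le_div_iff₀ (by positivity) (by positivity)]
    have hlt : (((x'.1 ν).val % L ^ r : ℕ) : ℝ) ≤ ((L ^ r : ℕ) : ℝ) := by exact_mod_cast (Nat.mod_lt _ (pow_pos hL r)).le
    have hmul := mul_le_mul_of_nonneg_right hlt (by positivity : (0 : ℝ) ≤ ((L ^ kk : ℕ) : ℝ) * w)
    push_cast at hmul ⊢
    nlinarith
  calc π * ∑ ν, |cenRep (2 * q) (coverXi M (L ^ r * L ^ kk) w ν x' - coverXi M (L ^ kk) w ν (kingPrV L kk r M x'))| ≤ π * ∑ _ν : Fin (d + 1), 1 / (((L ^ kk : ℕ) : ℝ) * w) :=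
        mul_le_mul_of_nonneg_left (Finset.sum_le_sum fun ν _ => hterm ν) pi_pos.le
    _ = π * (d + 1) / (((L ^ kk : ℕ) : ℝ) * w) := by rw [Finset.sum_const, Finset.card_univ, Fintype.card_fin, nsmul_eq_mul]; push_cast; field_simp

/-- ★★ **THE SHIFTED VALUE FIT `hfit₁` AT THE COVER**: `|χ̃′_k(x′ + e′_μ) − χ̃_k(πx′ + e_μ)| ≤ π(d+1)∕(L^k w)` (FILE III v1.1 `abs_bcube_shift_sub_bcube_shift_le` with FILE 66
`coverXi_shift` ×2 and FILE 67 `coverXi_offset`). [cite: Balaban1985BackgroundPropagators, (3.62)–(3.65) pp.402–403 (shape), Thm 3.14 pp.426–427 (difference template)] -/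
theorem abs_bcube_cover_shift_fine_sub_le (hM : ∀ ν, M ν = 2 * q * w) (hw : 0 < w) (k : Fin (d + 1) → ZMod (2 * q)) (μ : Fin (d + 1)) (x' : Tor (fine (L ^ r * L ^ kk) M) × Fin (d + 1)) :
    |bcube (2 * q) (coverXi M (L ^ r * L ^ kk) w) R k (bshiftEquiv M (L ^ r * L ^ kk) μ x') - bcube (2 * q) (coverXi M (L ^ kk) w) R k (bshiftEquiv M (L ^ kk) μ (kingPrV L kk r M x'))|
      ≤ π * (d + 1) / (((L ^ kk : ℕ) : ℝ) * w) := by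
  obtain ⟨hLr, hs0, -, hsL, -, -⟩ := coverBump_params (L := L) (kk := kk) (r := r) hw
  have h := abs_bcube_shift_sub_bcube_shift_le (2 * q) (coverXi M (L ^ kk) w) (coverXi M (L ^ r * L ^ kk) w) R (kingPrV L kk r M) (bshiftEquiv M (L ^ kk))
    (bshiftEquiv M (L ^ r * L ^ kk)) (two_mul_q_pos_of_cover hM) hLr hs0 hsL (fun μ ν b => coverXi_shift (n := L ^ kk) hM hw μ ν b)
    (fun μ ν b => coverXi_shift (n := L ^ r * L ^ kk) hM hw μ ν b) (fun ν x' => coverXi_offset (M := M) (L := L) (kk := kk) (r := r) (w := w) (q := q) ν x') k μ x'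
  refine h.trans (le_of_eq ?_)
  rw [Fintype.card_fin]; push_cast; rw [div_eq_mul_inv]; ring

/-- ★★ **THE BACKWARD-SHIFTED VALUE FIT `hfit₁b` AT THE COVER**: `|χ̃′_k(x′ − e′_μ) − χ̃_k(πx′ − e_μ)| ≤ 2π(d+1)∕(L^k w)` (FILE III v1.1 `abs_bcube_shift_symm_sub_bcube_shift_symm_le`).
[cite: Balaban1985BackgroundPropagators, (3.62)–(3.65) pp.402–403 (shape), Thm 3.14 pp.426–427 (difference template)] -/
theorem abs_bcube_cover_shift_symm_fine_sub_le (hM : ∀ ν, M ν = 2 * q * w) (hw : 0 < w) (k : Fin (d + 1) → ZMod (2 * q)) (μ : Fin (d + 1)) (x' : Tor (fine (L ^ r * L ^ kk) M) × Fin (d + 1)) :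
    |bcube (2 * q) (coverXi M (L ^ r * L ^ kk) w) R k ((bshiftEquiv M (L ^ r * L ^ kk) μ).symm x') -
        bcube (2 * q) (coverXi M (L ^ kk) w) R k ((bshiftEquiv M (L ^ kk) μ).symm (kingPrV L kk r M x'))| ≤ 2 * (π * (d + 1) / (((L ^ kk : ℕ) : ℝ) * w)) := by
  obtain ⟨hLr, hs0, -, hsL, -, -⟩ := coverBump_params (L := L) (kk := kk) (r := r) hw
  have h := abs_bcube_shift_symm_sub_bcube_shift_symm_le (2 * q) (coverXi M (L ^ kk) w) (coverXi M (L ^ r * L ^ kk) w) R (kingPrV L kk r M) (bshiftEquiv M (L ^ kk))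
    (bshiftEquiv M (L ^ r * L ^ kk)) (two_mul_q_pos_of_cover hM) hLr hs0 hsL (fun μ ν b => coverXi_shift (n := L ^ kk) hM hw μ ν b)
    (fun μ ν b => coverXi_shift (n := L ^ r * L ^ kk) hM hw μ ν b) (fun ν x' => coverXi_offset (M := M) (L := L) (kk := kk) (r := r) (w := w) (q := q) ν x') k μ x'
  refine h.trans (le_of_eq ?_)
  rw [Fintype.card_fin]; push_cast; rw [div_eq_mul_inv]; ring

/-- ★ `hfit₁` with the COMMON letter `oχ₁ = 2π(d+1)∕(L^k w)` files 45∕48 use for both shifted fits. [folklore] -/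
theorem abs_bcube_cover_shift_fine_sub_le_two (hM : ∀ ν, M ν = 2 * q * w) (hw : 0 < w) (k : Fin (d + 1) → ZMod (2 * q)) (μ : Fin (d + 1)) (x' : Tor (fine (L ^ r * L ^ kk) M) × Fin (d + 1)) :
    |bcube (2 * q) (coverXi M (L ^ r * L ^ kk) w) R k (bshiftEquiv M (L ^ r * L ^ kk) μ x') - bcube (2 * q) (coverXi M (L ^ kk) w) R k (bshiftEquiv M (L ^ kk) μ (kingPrV L kk r M x'))|
      ≤ 2 * (π * (d + 1) / (((L ^ kk : ℕ) : ℝ) * w)) := by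
  have h0 : (0 : ℝ) ≤ π * (d + 1) / (((L ^ kk : ℕ) : ℝ) * w) := by positivity
  linarith [abs_bcube_cover_shift_fine_sub_le R hM hw k μ x']

/-- ★★★ **THE DIFFERENCE-QUOTIENT FIT `hfit₂` AT THE COVER**: `|∇′_μχ̃′_k(x′) − (∇_μχ̃_k)(πx′)| ≤ w⁻¹·(L^k w)⁻¹·(32π⁴ + π²(d+1))` (FILE III `abs_fgrad_bcube_two_grid_le` at
`s = (L^k w)⁻¹`, `s′ = (L^r L^k w)⁻¹`, refinement `L^r`, `κ = w⁻¹`; `0 ≤ R`, `2R + 4 ≤ 2q`). [cite: Balaban1985BackgroundPropagators, (3.62)–(3.65) pp.402–403 (shape), Thm 3.14 pp.426–427 (difference template)] -/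
theorem abs_fgrad_bcube_cover_two_grid_le (hM : ∀ ν, M ν = 2 * q * w) (hw : 0 < w) (hR : 0 ≤ R) (hRq : 2 * R + 4 ≤ ((2 * q : ℕ) : ℝ)) (k : Fin (d + 1) → ZMod (2 * q)) (μ : Fin (d + 1))
    (x' : Tor (fine (L ^ r * L ^ kk) M) × Fin (d + 1)) :
    |fgrad ((L ^ r * L ^ kk : ℕ) : ℝ) (bshiftEquiv M (L ^ r * L ^ kk) μ) (bcube (2 * q) (coverXi M (L ^ r * L ^ kk) w) R k) x'
        - fgrad ((L ^ kk : ℕ) : ℝ) (bshiftEquiv M (L ^ kk) μ) (bcube (2 * q) (coverXi M (L ^ kk) w) R k) (kingPrV L kk r M x')|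
      ≤ ((w : ℝ))⁻¹ * (((L ^ kk : ℕ) : ℝ) * w)⁻¹ * (32 * π ^ 4 + π ^ 2 * (d + 1)) := by
  have hw' : (0 : ℝ) < w := by exact_mod_cast hw
  obtain ⟨hLr, hs0, hs1, hsL, hn, hn'⟩ := coverBump_params (L := L) (kk := kk) (r := r) hw
  have h := abs_fgrad_bcube_two_grid_le (2 * q) (coverXi M (L ^ kk) w) (coverXi M (L ^ r * L ^ kk) w) R (kingPrV L kk r M) (bshiftEquiv M (L ^ kk))
    (bshiftEquiv M (L ^ r * L ^ kk)) (two_mul_q_pos_of_cover hM) hR hRq hLr hs0 hs1 hsL hn hn' (fun μ ν b => coverXi_shift (n := L ^ kk) hM hw μ ν b)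
    (fun μ ν b => coverXi_shift (n := L ^ r * L ^ kk) hM hw μ ν b) (fun ν x' => coverXi_offset (M := M) (L := L) (kk := kk) (r := r) (w := w) (q := q) ν x') k μ x'
  rw [Fintype.card_fin, abs_of_nonneg (by positivity : (0 : ℝ) ≤ ((w : ℝ))⁻¹)] at h
  refine h.trans (le_of_eq ?_)
  push_cast; ring

/-- ★★★ **THE BACKWARD DIFFERENCE-QUOTIENT FIT `hfit₂b` AT THE COVER**: `|∇′⁻_μχ̃′_k(x′) − (∇⁻_μχ̃_k)(πx′)| ≤ w⁻¹·(L^k w)⁻¹·(32π⁴ + π²(d+1))` (FILE III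
`abs_bgrad_bcube_two_grid_le`). [cite: Balaban1985BackgroundPropagators, (3.62)–(3.65) pp.402–403 (shape), Thm 3.14 pp.426–427 (difference template)] -/
theorem abs_bgrad_bcube_cover_two_grid_le (hM : ∀ ν, M ν = 2 * q * w) (hw : 0 < w) (hR : 0 ≤ R) (hRq : 2 * R + 4 ≤ ((2 * q : ℕ) : ℝ)) (k : Fin (d + 1) → ZMod (2 * q)) (μ : Fin (d + 1))
    (x' : Tor (fine (L ^ r * L ^ kk) M) × Fin (d + 1)) :
    |bgrad ((L ^ r * L ^ kk : ℕ) : ℝ) (bshiftEquiv M (L ^ r * L ^ kk) μ) (bcube (2 * q) (coverXi M (L ^ r * L ^ kk) w) R k) x'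
        - bgrad ((L ^ kk : ℕ) : ℝ) (bshiftEquiv M (L ^ kk) μ) (bcube (2 * q) (coverXi M (L ^ kk) w) R k) (kingPrV L kk r M x')|
      ≤ ((w : ℝ))⁻¹ * (((L ^ kk : ℕ) : ℝ) * w)⁻¹ * (32 * π ^ 4 + π ^ 2 * (d + 1)) := by
  have hw' : (0 : ℝ) < w := by exact_mod_cast hw
  obtain ⟨hLr, hs0, hs1, hsL, hn, hn'⟩ := coverBump_params (L := L) (kk := kk) (r := r) hw
  have h := abs_bgrad_bcube_two_grid_le (2 * q) (coverXi M (L ^ kk) w) (coverXi M (L ^ r * L ^ kk) w) R (kingPrV L kk r M) (bshiftEquiv M (L ^ kk))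
    (bshiftEquiv M (L ^ r * L ^ kk)) (two_mul_q_pos_of_cover hM) hR hRq hLr hs0 hs1 hsL hn hn' (fun μ ν b => coverXi_shift (n := L ^ kk) hM hw μ ν b)
    (fun μ ν b => coverXi_shift (n := L ^ r * L ^ kk) hM hw μ ν b) (fun ν x' => coverXi_offset (M := M) (L := L) (kk := kk) (r := r) (w := w) (q := q) ν x') k μ x'
  rw [Fintype.card_fin, abs_of_nonneg (by positivity : (0 : ℝ) ≤ ((w : ℝ))⁻¹)] at h
  refine h.trans (le_of_eq ?_)
  push_cast; ring

end TwoGrid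

end Summit.QuantumFields.YangMills.BalabanUVNodes.N15.Gluing

end
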